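import Literature.Analysis.FluidPDE.CheskidovCutoffs
import Literature.Analysis.FluidPDE.TorusForceBookkeeping
import Literature.Analysis.FunctionSpaces.TorusTimePeriodization
import HarnessLib

/-!
# Cheskidov's periodisation, II: the periodised family

Analysis/FluidPDE support file for the §6 periodisation step of Cheskidov, arXiv:2311.04182
(2023), Thm. 1.3. The data of the total-dissipation family
(`Literature.Analysis.FluidPDE.cheskidov_total_dissipation_family`, one existential statement) are
bundled as the hypothesis structure `CheskidovPeriodic.FamilyData` (`FamilyData.nonempty` unpacks
the named fact), and the objects of §6, p. 18 are built from it with period `τ = 1` and window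
`[2/5, 7/5)`:

* `FamilyData.theta1 D m = η • θ^m`, `FamilyData.v1 D m = η̃ • v^m` (cut-off density and drift;
  smooth on `ℝ × T²`, vanishing for `t ∉ (9/20, 33/25)` — a deliberately loose envelope of the
  sharp supports `(7/10, 13/10)` resp. `(1/2, 1)`, chosen inside the periodisation window);
* `FamilyData.theta2`, `FamilyData.v2` — their `1`-periodisations (`timePeriodize (2/5) 1`), smooth,
  `1`-periodic, `v2` divergence free and mean zero, `theta2` mean zero, with the energy bounds
  `∫ θ₂² ≤ 1` (from `‖θ^m(t)‖ ≤ ‖ρ_in‖ = 1`) and `∫ ‖v₂‖² ≤ B` ((6.5)).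

The force identities ((6.7) and the drift-force decomposition) are proved in the follow-up file
`CheskidovForceIdentities`.

## References

* A. Cheskidov, arXiv:2311.04182 (2023), §6, p. 18 (cutoffs and periodisation), (6.5); §4, p. 12
  (energy inequality for `θ^m`).
-/

open MeasureTheory Set Filter Topology Function
open Literature.Analysis.FunctionSpaces (timePeriodize)

noncomputable section

namespace Literature.Analysis.FluidPDE

namespace CheskidovPeriodic

/-- The flat two-torus (local notation). [folklore] -/
local notation "𝕋²" => UnitAddTorus (Fin 2)
/-- `ℝ²` (local notation). [folklore] -/
local notation "E²" => EuclideanSpace ℝ (Fin 2)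

/-! ## The data of the total-dissipation family as a hypothesis structure -/

/-- **The total-dissipation family of Cheskidov 2023, §§3–4, as data** — a hypothesis structure
carrying exactly the clauses of the named fact
`Literature.Analysis.FluidPDE.cheskidov_total_dissipation_family` (viscosities `ν_m → 0`, glued ACM/BDL drifts
`v^m`, datum `ρ_in`, advection–diffusion solutions `θ^m` on `[0,2]` with the total dissipation
anomaly (6.4), inviscid profile `ρ̃`, limit force `g`; see `CheskidovTotalDissipation.lean` for the
clause-by-clause provenance). `FamilyData.nonempty` produces it from the fact. [cite: Cheskidov2023, §4 (4.2)–(4.13), (4.20) and §6 (6.2)–(6.5)] -/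
structure FamilyData where
  /-- viscosities `ν_m` -/
  ν : ℕ → ℝ
  /-- the planar drifts `v^m` -/
  v : ℕ → ℝ → 𝕋² → E²
  /-- the datum `ρ_in` -/
  ρin : 𝕋² → ℝ
  /-- the advection–diffusion solutions `θ^m` (`θ̃^m` in §6) -/
  θ : ℕ → ℝ → 𝕋² → ℝ
  /-- the inviscid profile `ρ̃` -/
  ρ : ℝ → 𝕋² → ℝ
  /-- the limit Navier–Stokes force `g` of the drifts -/
  g : ℝ → 𝕋² → E²
  /-- the uniform `L²` bound of the drifts -/
  B : ℝ
  ν_pos : ∀ m, 0 < ν m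
  ν_tendsto : Tendsto ν atTop (𝓝 0)
  v_smooth : ∀ m, FunctionSpaces.Torus.IsSmoothSpaceTimeOn univ (v m)
  v_divFree : ∀ m t, FunctionSpaces.Torus.IsDivFree (v m t)
  v_zeroMean : ∀ m t, FunctionSpaces.Torus.HasZeroMean (v m t)
  v_eq_zero : ∀ m, ∀ t ∉ Ioo (0 : ℝ) 1, v m t = 0
  v_sq_le : ∀ m t, ∫ x, ‖v m t x‖ ^ 2 ≤ B
  v_stationary : ∀ T < (1 : ℝ), ∃ m₁ : ℕ, ∀ m ≥ m₁, ∀ t ≤ T, v m t = v m₁ t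
  ρin_smooth : FunctionSpaces.Torus.IsSmooth ρin
  ρin_zeroMean : FunctionSpaces.Torus.HasZeroMean ρin
  ρin_sq : ∫ x, ρin x ^ 2 = 1
  θ_transport : ∀ m, Torus.IsClassicalScalarTransportOn (Icc 0 2) (ν m) (v m) (θ m)
  θ_zero : ∀ m, θ m 0 = ρin
  θ_zeroMean : ∀ m, ∀ t ∈ Icc (0 : ℝ) 2, FunctionSpaces.Torus.HasZeroMean (θ m t)
  θ_antitone : ∀ m, AntitoneOn (fun t => ∫ x, θ m t x ^ 2) (Icc (0 : ℝ) 2)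
  θ_one : Tendsto (fun m => ∫ x, θ m 1 x ^ 2) atTop (𝓝 0)
  θ_dissipation : ∀ s ∈ Ico (0 : ℝ) 1,
    Tendsto (fun m => 2 * ν m * ∫ t in s..1, Torus.scalarGradNormSq (θ m t)) atTop (𝓝 1)
  ρ_smooth : FunctionSpaces.Torus.IsSmoothSpaceTimeOn (Ico 0 1) ρ
  θ_sub_ρ : ∀ T ∈ Ico (0 : ℝ) 1,
    Tendsto (fun m => ⨆ t ∈ Icc (0 : ℝ) T, eLpNorm (θ m t - ρ t) 2 volume) atTop (𝓝 0)
  g_smooth : ∀ t, FunctionSpaces.Torus.IsSmooth (g t)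
  g_cont : Torus.ContinuousInLpOn univ 2 g
  g_limit : Tendsto (fun m => ⨆ t : ℝ, eLpNorm (Torus.nsBodyForce (ν m) (v m) t - g t) 2 volume)
    atTop (𝓝 0)

/-- The named fact `cheskidov_total_dissipation_family` provides `FamilyData`. [cite: Cheskidov2023, §4 (4.2)–(4.13), (4.20) and §6 (6.2)–(6.5)] -/
theorem FamilyData.nonempty (h : cheskidov_total_dissipation_family) : Nonempty FamilyData := by
  obtain ⟨ν, v, ρin, θ, ρ, g, B, h1, h2, h3, h4, h5, h6, h7, h8, h9, h10, h11, h12, h13, h14, h15, h16,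
    h17, h18, h19, h20⟩ := h
  exact ⟨⟨ν, v, ρin, θ, ρ, g, B, h1, h2, h3, fun m t => (h4 m t).1, fun m t => (h4 m t).2, h5, h6, h7,
    h8, h9, h10, fun m => (h11 m).1, fun m => (h11 m).2, h12, h13, h14, h15, h16, h17, h18, h19, h20⟩⟩

namespace FamilyData

variable (D : FamilyData)

/-! ## Elementary consequences -/

/-- `θ^m` is jointly smooth on `[0,2] × T²`. [folklore] -/
theorem θ_smooth (m : ℕ) : FunctionSpaces.Torus.IsSmoothSpaceTimeOn (Icc 0 2) (D.θ m) :=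
  (D.θ_transport m).smooth_scalar

/-- `‖θ^m(t)‖²_{L²} ≤ 1` on `[0, 2]` (energy decay from `‖ρ_in‖ = 1`). [cite: Cheskidov2023, §4 p. 12] -/
theorem θ_sq_le_one (m : ℕ) {t : ℝ} (ht : t ∈ Icc (0 : ℝ) 2) : ∫ x, D.θ m t x ^ 2 ≤ 1 := by
  have h := D.θ_antitone m (left_mem_Icc.2 (by norm_num)) ht ht.1
  simp only [D.θ_zero m, D.ρin_sq] at h
  exact h

/-- `‖θ^m(t)‖²_{L²} ≤ ‖θ^m(1)‖²_{L²}` for `t ∈ [1, 2]`. [cite: Cheskidov2023, §4 p. 12] -/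
theorem θ_sq_le_θ_one (m : ℕ) {t : ℝ} (ht : t ∈ Icc (1 : ℝ) 2) :
    ∫ x, D.θ m t x ^ 2 ≤ ∫ x, D.θ m 1 x ^ 2 :=
  D.θ_antitone m ⟨by norm_num, by norm_num⟩ ⟨by linarith [ht.1], ht.2⟩ ht.1

/-- `0 ≤ B`. [folklore] -/
theorem B_nonneg : 0 ≤ D.B :=
  (integral_nonneg fun _ => sq_nonneg _).trans (D.v_sq_le 0 0)

/-! ## The cut-off density and drift -/

/-- The cut-off density `θ₁^m(t) = η(t) θ^m(t)` (Cheskidov 2023, §6, p. 18: `θ̃^m η`). [cite: Cheskidov2023, §6 p. 18] -/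
def theta1 (m : ℕ) (t : ℝ) (x : 𝕋²) : ℝ := eta t • D.θ m t x

/-- The cut-off drift `v₁^m(t) = η̃(t) v^m(t)` (Cheskidov 2023, §6, p. 18: `ṽ^m η̃`). [cite: Cheskidov2023, §6 p. 18] -/
def v1 (m : ℕ) (t : ℝ) (x : 𝕋²) : E² := etaTilde t • D.v m t x

/-- `θ₁^m` is jointly smooth on `ℝ × T²` (`supp η ⊂ (0, 2)`). [folklore] -/
theorem theta1_smooth (m : ℕ) : FunctionSpaces.Torus.IsSmoothSpaceTimeOn univ (D.theta1 m) := by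
  refine (D.θ_smooth m).cutoff contDiff_eta ?_
  rw [tsupport_eta, interior_Icc]
  exact Icc_subset_Ioo (by norm_num) (by norm_num)

/-- `v₁^m` is jointly smooth on `ℝ × T²`. [folklore] -/
theorem v1_smooth (m : ℕ) : FunctionSpaces.Torus.IsSmoothSpaceTimeOn univ (D.v1 m) :=
  (D.v_smooth m).cutoff contDiff_etaTilde (by simp)

/-- `θ₁^m(t) = 0` for `t ∉ (9/20, 33/25)` (loose envelope of the sharp `(7/10, 13/10)`, placed inside
the periodisation window `[2/5, 7/5)` as `IsSmoothSpaceTimeOn.timePeriodize` wants). [folklore] -/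
theorem theta1_eq_zero (m : ℕ) {t : ℝ} (ht : t ∉ Ioo (9 / 20 : ℝ) (33 / 25)) : D.theta1 m t = 0 := by
  funext x
  rw [theta1, eta_eq_zero fun h => ht ⟨by linarith [h.1], by linarith [h.2]⟩, zero_smul, Pi.zero_apply]

/-- `v₁^m(t) = 0` for `t ∉ (9/20, 33/25)` (`η̃ = 0` for `t ≤ 1/2`, `v^m = 0` for `t ≥ 1`; the same loose
envelope as for `θ₁^m`). [folklore] -/
theorem v1_eq_zero (m : ℕ) {t : ℝ} (ht : t ∉ Ioo (9 / 20 : ℝ) (33 / 25)) : D.v1 m t = 0 := by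
  funext x
  rw [v1, Pi.zero_apply]
  by_cases h : t ≤ 2⁻¹
  · rw [etaTilde_of_le h, zero_smul]
  · rw [D.v_eq_zero m t fun h' => ht ⟨by linarith [h'.1], by linarith [h'.2]⟩, Pi.zero_apply,
      smul_zero]

/-- `∫ θ₁^m(t)² ≤ 1` for all `t`. [cite: Cheskidov2023, §6 p. 18] -/
theorem theta1_sq_le (m : ℕ) (t : ℝ) : ∫ x, D.theta1 m t x ^ 2 ≤ 1 := by
  by_cases ht : t ∈ Icc (0 : ℝ) 2
  · have h1 : ∀ x, D.theta1 m t x ^ 2 = eta t ^ 2 * D.θ m t x ^ 2 := fun x => by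
      rw [theta1, smul_eq_mul, mul_pow]
    simp_rw [h1, integral_const_mul]
    have he := eta_mem_Icc t
    calc eta t ^ 2 * ∫ x, D.θ m t x ^ 2 ≤ 1 * ∫ x, D.θ m t x ^ 2 :=
          mul_le_mul_of_nonneg_right (by nlinarith [he.1, he.2])
            (integral_nonneg fun x => sq_nonneg _)
      _ ≤ 1 := by rw [one_mul]; exact D.θ_sq_le_one m ht
  · rw [D.theta1_eq_zero m fun h => ht ⟨by linarith [h.1], by linarith [h.2]⟩]
    simp

/-- `∫ ‖v₁^m(t)‖² ≤ B` for all `t`. [cite: Cheskidov2023, §6 (6.5)] -/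
theorem v1_sq_le (m : ℕ) (t : ℝ) : ∫ x, ‖D.v1 m t x‖ ^ 2 ≤ D.B := by
  have h1 : ∀ x, ‖D.v1 m t x‖ ^ 2 = etaTilde t ^ 2 * ‖D.v m t x‖ ^ 2 := fun x => by
    rw [v1, norm_smul, mul_pow, Real.norm_eq_abs, sq_abs]
  simp_rw [h1, integral_const_mul]
  have he := etaTilde_mem_Icc t
  calc etaTilde t ^ 2 * ∫ x, ‖D.v m t x‖ ^ 2 ≤ 1 * ∫ x, ‖D.v m t x‖ ^ 2 :=
        mul_le_mul_of_nonneg_right (by nlinarith [he.1, he.2])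
          (integral_nonneg fun x => sq_nonneg _)
    _ ≤ D.B := by rw [one_mul]; exact D.v_sq_le m t

/-- `v₁^m(t)` is divergence free. [folklore] -/
theorem v1_divFree (m : ℕ) (t : ℝ) : FunctionSpaces.Torus.IsDivFree (D.v1 m t) :=
  Torus.isDivFree_const_smul (((D.v_smooth m).isSmooth_slice (mem_univ t)).isContDiff (by simp))
    (D.v_divFree m t) _

/-- `v₁^m(t)` has zero mean. [folklore] -/
theorem v1_zeroMean (m : ℕ) (t : ℝ) : FunctionSpaces.Torus.HasZeroMean (D.v1 m t) :=
  Torus.hasZeroMean_const_smul (D.v_zeroMean m t) _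

/-- `θ₁^m(t)` has zero mean. [folklore] -/
theorem theta1_zeroMean (m : ℕ) (t : ℝ) : FunctionSpaces.Torus.HasZeroMean (D.theta1 m t) := by
  by_cases ht : t ∈ Icc (0 : ℝ) 2
  · exact Torus.hasZeroMean_const_smul (D.θ_zeroMean m t ht) _
  · rw [D.theta1_eq_zero m fun h => ht ⟨by linarith [h.1], by linarith [h.2]⟩]
    simp [FunctionSpaces.Torus.HasZeroMean]

/-! ## The periodised density and drift -/

/-- The periodised density `θ₂^m = ∑ₙ (η θ^m)(· + n)` (period `1`, window `[2/5, 7/5)`;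
Cheskidov 2023, §6, p. 18, `θ^m(t) := ∑ θ̃^m(t+τn) η(t+τn)`). [cite: Cheskidov2023, §6 p. 18] -/
def theta2 (m : ℕ) : ℝ → 𝕋² → ℝ := timePeriodize (2 / 5) 1 (D.theta1 m)

/-- The periodised drift `v₂^m = ∑ₙ (η̃ v^m)(· + n)` (Cheskidov 2023, §6, p. 18,
`v^m(t) := ∑ ṽ^m(t+τn) η̃(t+τn)`). [cite: Cheskidov2023, §6 p. 18] -/
def v2 (m : ℕ) : ℝ → 𝕋² → E² := timePeriodize (2 / 5) 1 (D.v1 m)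

/-- `θ₂^m` is jointly smooth. [cite: Cheskidov2023, §6 p. 18] -/
theorem theta2_smooth (m : ℕ) : FunctionSpaces.Torus.IsSmoothSpaceTimeOn univ (D.theta2 m) :=
  (D.theta1_smooth m).timePeriodize one_pos (by norm_num) (by norm_num) fun _ ht => D.theta1_eq_zero m ht

/-- `v₂^m` is jointly smooth. [cite: Cheskidov2023, §6 p. 18] -/
theorem v2_smooth (m : ℕ) : FunctionSpaces.Torus.IsSmoothSpaceTimeOn univ (D.v2 m) :=
  (D.v1_smooth m).timePeriodize one_pos (by norm_num) (by norm_num) fun _ ht => D.v1_eq_zero m ht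

/-- `θ₂^m` is `1`-periodic. [folklore] -/
theorem theta2_periodic (m : ℕ) : Periodic (D.theta2 m) 1 :=
  Literature.Analysis.FunctionSpaces.periodic_timePeriodize one_pos _

/-- `v₂^m` is `1`-periodic. [folklore] -/
theorem v2_periodic (m : ℕ) : Periodic (D.v2 m) 1 :=
  Literature.Analysis.FunctionSpaces.periodic_timePeriodize one_pos _

/-- `v₂^m(t)` is divergence free. [folklore] -/
theorem v2_divFree (m : ℕ) (t : ℝ) : FunctionSpaces.Torus.IsDivFree (D.v2 m t) :=
  D.v1_divFree m _

/-- `v₂^m(t)` has zero mean. [folklore] -/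
theorem v2_zeroMean (m : ℕ) (t : ℝ) : FunctionSpaces.Torus.HasZeroMean (D.v2 m t) :=
  D.v1_zeroMean m _

/-- `θ₂^m(t)` has zero mean. [folklore] -/
theorem theta2_zeroMean (m : ℕ) (t : ℝ) : FunctionSpaces.Torus.HasZeroMean (D.theta2 m t) :=
  D.theta1_zeroMean m _

/-- `∫ θ₂^m(t)² ≤ 1`. [cite: Cheskidov2023, §6 p. 18] -/
theorem theta2_sq_le (m : ℕ) (t : ℝ) : ∫ x, D.theta2 m t x ^ 2 ≤ 1 := D.theta1_sq_le m _

/-- `∫ ‖v₂^m(t)‖² ≤ B`. [cite: Cheskidov2023, §6 (6.5)] -/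
theorem v2_sq_le (m : ℕ) (t : ℝ) : ∫ x, ‖D.v2 m t x‖ ^ 2 ≤ D.B := D.v1_sq_le m _

end FamilyData

end CheskidovPeriodic

end Literature.Analysis.FluidPDE

end
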